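import Summits.QuantumFields.YangMills.Theorems.BalabanUVNodesN15BackgroundMatrixByPartsTwoSidedLetters
import Summits.QuantumFields.YangMills.Theorems.BalabanUVNodesN15BackgroundMatrixByPartsNodeTwoSided
import HarnessLib

/-!
# `T4EtaRate.NE2PlusOperator` BY NAME FOR THE TWO-SIDED BY-PARTS MATRIX FAMILY WITH AN ARBITRARY COARSE PARTNER (transport-generic readings): the letter bundle
# `TwoSidedLetters`, the four entry operators `bgOpsM₂R` at explicit fine ∕ coarse configurations, the per-index rate inequality and the node theorem (dag-n15-c g9, FILE 24;
# Track-A node N15 = NE2, s1 «background-layer OPERATOR ingredient»)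

`--kind definition --supports stmt-QuantumFields-20544 --as helper` (K3⁷; count-neutral).  Imports BY NAME this seat's FILE 23 `…N15BackgroundMatrixByPartsTwoSidedLetters` (`bpConst2L`,
★★ `hasMaj_entry2_byParts_matrix₂_of_letters`; through it g2 V0 `hasMaj_entries_of_letters`, FILE 19 `e2OpMBP₂`, M1 `unstackM` ∕ `bgPairM` ∕ `hasMaj_unstackM` ∕ `hasMaj_idef_unstackM`) and FILE 20
`…N15BackgroundMatrixByPartsNodeTwoSided` (through it FILE 7b `rowConst_small`, `bgConst` ∕ `bgConst1` ∕ `one_le_pref4`, n15-b `etaRateIneq342_of_hasMaj_rateWeight`); nothing in the tree is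
modified.

WHAT.  §1 `TwoSidedLetters π τ τ′ n n′ a θ CF CC` (def, Prop): the fifteen coefficient letters of the two-sided by-parts layer between an ARBITRARY fine configuration `CF = (C′, Â′)` and an
ARBITRARY coarse configuration `CC = (C, Â)` at scale `a` (rows, gradients `≤ a`; fits, translated fits, derivative fits, coarse oscillation `≤ aθ`); `bgOpsM₂R cfgF cfgC …` (def): FILE 19's
four entry operators with the coarse partner READ from the configuration by `cfgC` instead of the entrywise block average; `bgFamilyM₂R`.  §2 `etaRateIneq342_twoSided_of_letters` (per index,
`B₀ = bgConst + bgConst1` at `K = 1 + |J ⊕ J|` `+ bpConst2L`, `δ₀ = δ − 6σ`; entries 0∕1∕3 by V0, entry 2 by FILE 23).  §3 ★★★ `ne2PlusOperator_twoSided_of_letters`: `NE2PlusOperator c₃₅`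
BY NAME for ANY realised family `⟨opGeo, fineGeo, B_c, B_f, pairing⟩` with readings `cfgF, cfgC` whose carrier's (3.35) regularity at level `c₃₅` DELIVERS the letter bundle at scale
`κ·c₃₅·M·α₀` (and the shift-defect row letter, linear in that scale) — uniform `U ≡ 1` letters on the product carriers as in FILE 20.

WHY.  The coarse coefficients of Bałaban's OWN species (3.52) are `ad`-polynomials of the COARSE gauge field, not entrywise block averages of the fine coefficients; this node theorem is the
socket the genuine species plugs into (readings = g2 V1a `v1coefC` ∕ `v1coefA` of the fine gauge field and of its block mean).

HONEST FRAMING.  Bookkeeping over tree theorems; the `U ≡ 1` layer and the letter bundle DISPLAYED; nothing about Bałaban's `G(U)` asserted; NE2⁺ NOT PRINTED; N15 not discharged; nothing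
continuum ∕ OS ∕ mass-gap ∕ Clay.
-/

noncomputable section

open scoped BigOperators
open Finset

namespace Summit.QuantumFields.YangMills.BalabanUVNodes.N15.BackgroundLayer

open Literature.MathematicalPhysics.QuantumFieldTheory.Balaban1983to89
open Literature.MathematicalPhysics.QuantumFieldTheory.Balaban1983to89.B11SectG (BlockNorm HasMaj RowSum hasMaj_comp hasMaj_comp_exp hasMaj_zero)
open Literature.MathematicalPhysics.QuantumFieldTheory.Balaban1983to89.T4EtaRate (PairedInstance EtaPairing EtaRateIneq342 NE2PlusOperator rateFactor)
open Literature.MathematicalPhysics.QuantumFieldTheory.Balaban1983to89.T4EtaRateDefect (idef idef_apply idef_comp idef_zero rateWeight)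
open Literature.MathematicalPhysics.QuantumFieldTheory.Balaban1983to89.T4EtaRateCoeffDefect (pull pull_apply diagK diagK_nonneg)
open Literature.MathematicalPhysics.QuantumFieldTheory.Balaban1983to89.B6RandomWalk (Triangle254)
open Summit.QuantumFields.YangMills.BalabanUVNodes.N15.OperatorReadout (opGeo opFamily opGeo_len rateFactor_opGeo etaRateIneq342_of_hasMaj_rateWeight)
open Summit.QuantumFields.YangMills.BalabanUVNodes.N15.MatrixSpecies (mmulOp liftEquiv liftMap liftBlk)
open Summit.QuantumFields.YangMills.BalabanUVNodes.N15.SiteLayer (hasMaj_exp_comp_diagK hasMaj_diagK_comp_exp hasMaj_add_exp hasMaj_exp_mono)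

variable {d : ℕ}

/-! ## §1 The letter bundle and the entry operators at explicit configurations -/

section Defs

variable {X X' : Type} (J ι : Type) [Fintype ι] [Fintype X'] [DecidableEq X]

/-- **THE FIFTEEN COEFFICIENT LETTERS OF THE TWO-SIDED BY-PARTS LAYER** between a fine configuration `CF = (C′, Â′)` and a coarse configuration `CC = (C, Â)` (`Â : J ⊕ J → …`: forward
coefficients on `inl`, backward on `inr`) at scale `a` and rate number `θ`: row sums of `C, Â, C′, Â′` (`≤ a`); row fits `C′ − C∘π`, `Â′ − Â∘π` (`≤ aθ`); gradient rows of the forward and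
backward coefficients at both spacings (`≤ a`); the forward translated fit along `e⁻¹`, the translated forward derivative fit, the coarse one-step oscillation of the forward coefficients, the
backward translated fit along `e`, the untranslated backward derivative fit (`≤ aθ`). [cite: Balaban1985BackgroundPropagators, (3.35)–(3.36) p.396 (shapes); (3.52) p.400] -/
def TwoSidedLetters (π : X' → X) (τ : J → X ≃ X) (τ' : J → X' ≃ X') (n n' a θ : ℝ) (CF : (X' → Matrix ι ι ℝ) × (J ⊕ J → X' → Matrix ι ι ℝ))
    (CC : (X → Matrix ι ι ℝ) × (J ⊕ J → X → Matrix ι ι ℝ)) : Prop :=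
  (∀ x i, ∑ j, |CC.1 x i j| ≤ a) ∧ (∀ μ x i, ∑ j, |CC.2 μ x i j| ≤ a) ∧ (∀ x' i, ∑ j, |CF.1 x' i j| ≤ a) ∧ (∀ μ x' i, ∑ j, |CF.2 μ x' i j| ≤ a) ∧
    (∀ x' i, ∑ j, |CF.1 x' i j - CC.1 (π x') i j| ≤ a * θ) ∧ (∀ μ x' i, ∑ j, |CF.2 μ x' i j - CC.2 μ (π x') i j| ≤ a * θ) ∧
    (∀ μ x i, ∑ j, |fgradMat n (τ μ) (CC.2 (Sum.inl μ)) x i j| ≤ a) ∧ (∀ μ x' i, ∑ j, |fgradMat n' (τ' μ) (CF.2 (Sum.inl μ)) x' i j| ≤ a) ∧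
    (∀ μ x i, ∑ j, |fgradMat n (τ μ) (CC.2 (Sum.inr μ)) x i j| ≤ a) ∧ (∀ μ x' i, ∑ j, |fgradMat n' (τ' μ) (CF.2 (Sum.inr μ)) x' i j| ≤ a) ∧
    (∀ μ x' i, ∑ j, |CF.2 (Sum.inl μ) ((τ' μ).symm x') i j - CC.2 (Sum.inl μ) ((τ μ).symm (π x')) i j| ≤ a * θ) ∧
    (∀ μ x' i, ∑ j, |fgradMat n' (τ' μ) (CF.2 (Sum.inl μ)) ((τ' μ).symm x') i j - fgradMat n (τ μ) (CC.2 (Sum.inl μ)) ((τ μ).symm (π x')) i j| ≤ a * θ) ∧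
    (∀ μ x i, ∑ j, |CC.2 (Sum.inl μ) x i j - CC.2 (Sum.inl μ) ((τ μ).symm x) i j| ≤ a * θ) ∧
    (∀ μ x' i, ∑ j, |CF.2 (Sum.inr μ) (τ' μ x') i j - CC.2 (Sum.inr μ) (τ μ (π x')) i j| ≤ a * θ) ∧
    (∀ μ x' i, ∑ j, |fgradMat n' (τ' μ) (CF.2 (Sum.inr μ)) x' i j - fgradMat n (τ μ) (CC.2 (Sum.inr μ)) (π x') i j| ≤ a * θ)

variable {J ι} [Fintype X] [Fintype J] [DecidableEq X'] [DecidableEq J] [DecidableEq ι]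

omit [Fintype X'] [DecidableEq X] [Fintype X] [Fintype J] [DecidableEq X'] [DecidableEq J] [DecidableEq ι] in
/-- The letter bundle is MONOTONE in the scale (`θ ≥ 0`). [folklore] -/
theorem TwoSidedLetters.mono {π : X' → X} {τ : J → X ≃ X} {τ' : J → X' ≃ X'} {n n' a a' θ : ℝ} {CF : (X' → Matrix ι ι ℝ) × (J ⊕ J → X' → Matrix ι ι ℝ)}
    {CC : (X → Matrix ι ι ℝ) × (J ⊕ J → X → Matrix ι ι ℝ)} (haa : a ≤ a') (hθ : 0 ≤ θ) (h : TwoSidedLetters J ι π τ τ' n n' a θ CF CC) :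
    TwoSidedLetters J ι π τ τ' n n' a' θ CF CC := by
  have h1 : a * θ ≤ a' * θ := mul_le_mul_of_nonneg_right haa hθ
  obtain ⟨hc, hA, hc', hA', hfc, hfA, hga, hga', hgb, hgb', hfaT, hfgT, hosc, hfbT, hfgb⟩ := h
  exact ⟨fun x i => (hc x i).trans haa, fun μ x i => (hA μ x i).trans haa, fun x' i => (hc' x' i).trans haa, fun μ x' i => (hA' μ x' i).trans haa,
    fun x' i => (hfc x' i).trans h1, fun μ x' i => (hfA μ x' i).trans h1, fun μ x i => (hga μ x i).trans haa, fun μ x' i => (hga' μ x' i).trans haa,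
    fun μ x i => (hgb μ x i).trans haa, fun μ x' i => (hgb' μ x' i).trans haa, fun μ x' i => (hfaT μ x' i).trans h1, fun μ x' i => (hfgT μ x' i).trans h1,
    fun μ x i => (hosc μ x i).trans h1, fun μ x' i => (hfbT μ x' i).trans h1, fun μ x' i => (hfgb μ x' i).trans h1⟩

/-- THE FOUR ENTRY OPERATORS OF THE TWO-SIDED BY-PARTS NON-ABELIAN PAIR AT EXPLICIT CONFIGURATIONS: FILE 19's `bgOpsMBP₂` with the coarse partner READ from the configuration by `cfgC`
(an arbitrary transport) instead of the entrywise block average. [cite: Balaban1985BackgroundPropagators, (3.42) p.397 (the four entries: shape)] -/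
def bgOpsM₂R {Cfg : Type} (cfgF : Cfg → (X' → Matrix ι ι ℝ) × (J ⊕ J → X' → Matrix ι ι ℝ)) (cfgC : Cfg → (X → Matrix ι ι ℝ) × (J ⊕ J → X → Matrix ι ι ℝ)) (π : X' → X)
    (τ : J → X ≃ X) (τ' : J → X' ≃ X') (n n' : ℝ) (ν : J) (G D₃ : (X × ι → ℝ) →ₗ[ℝ] (X × ι → ℝ)) (D : J ⊕ J → (X × ι → ℝ) →ₗ[ℝ] (X × ι → ℝ))
    (G' D₃' : (X' × ι → ℝ) →ₗ[ℝ] (X' × ι → ℝ)) (D' : J ⊕ J → (X' × ι → ℝ) →ₗ[ℝ] (X' × ι → ℝ)) : Fin 4 → Cfg → ((X × ι → ℝ) →ₗ[ℝ] (X' × ι → ℝ)) :=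
  fun k U => ![idef (pull (liftMap π ι)) (pull (liftMap π ι)) (projO none ∘ₗ bgPairM G' D' (cfgF U).1 (cfgF U).2) (projO none ∘ₗ bgPairM G D (cfgC U).1 (cfgC U).2),
    idef (pull (liftMap π ι)) (pull (liftMap π ι)) (projO (some (Sum.inl ν)) ∘ₗ bgPairM G' D' (cfgF U).1 (cfgF U).2)
      (projO (some (Sum.inl ν)) ∘ₗ bgPairM G D (cfgC U).1 (cfgC U).2),
    idef (pull (liftMap (liftMap π ι) J)) (pull (liftMap π ι)) (e2OpMBP₂ τ' n' G' D' (cfgF U).1 (cfgF U).2) (e2OpMBP₂ τ n G D (cfgC U).1 (cfgC U).2) ∘ₗ injJ ν,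
    idef (pull (liftMap π ι)) (pull (liftMap π ι)) (bgDerivedV (stack G' D') D₃' (unstackM (cfgF U).1 (cfgF U).2))
      (bgDerivedV (stack G D) D₃ (unstackM (cfgC U).1 (cfgC U).2))] k

/-- THE REALISED TWO-SIDED INSTANCE WITH AN ARBITRARY COEFFICIENT-CARRIER PAIR: operator geometry on `X × ι`, fine geometry on `X′ × ι` (`m` scales finer), carriers `B_c, B_f` and
their η-pairing `P` (NOT PRINTED data). [cite: King1986, p.664 (convention before Prop. 3.8)] -/
def bgInstanceM₂R {g : B6.Geometry} (blk : X → g.Site) (π : X' → X) (m : ℕ) (Bc Bf : B9.Backgrounds)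
    (P : EtaPairing (opGeo g (X × ι) (liftBlk blk ι)) (fineGeo g (X' × ι) (liftBlk (blk ∘ π) ι) m) Bc Bf) : PairedInstance :=
  ⟨opGeo g (X × ι) (liftBlk blk ι), fineGeo g (X' × ι) (liftBlk (blk ∘ π) ι) m, Bc, Bf, P⟩

omit [DecidableEq X] [DecidableEq X'] [DecidableEq ι] in
/-- THE GUARD IS LIVE: the fine geometry's size parameter is the datum's `M`. [folklore] -/
theorem bgInstanceM₂R_M {g : B6.Geometry} (blk : X → g.Site) (π : X' → X) (m : ℕ) (Bc Bf : B9.Backgrounds)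
    (P : EtaPairing (opGeo g (X × ι) (liftBlk blk ι)) (fineGeo g (X' × ι) (liftBlk (blk ∘ π) ι) m) Bc Bf) : (bgInstanceM₂R blk π m Bc Bf P).gf.M = g.M := rfl

/-- THE KERNEL FAMILY OF THE REALISED TWO-SIDED INSTANCE: the four entry operators `bgOpsM₂R` at the read configurations, as site kernels of the operator geometry (n15-b `opFamily`).
[cite: Balaban1985BackgroundPropagators, (3.42) p.397 (shape)] -/
def bgFamilyM₂R {g : B6.Geometry} (blk : X → g.Site) (π : X' → X) (m : ℕ) (Bc Bf : B9.Backgrounds)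
    (P : EtaPairing (opGeo g (X × ι) (liftBlk blk ι)) (fineGeo g (X' × ι) (liftBlk (blk ∘ π) ι) m) Bc Bf) (cfgF : Bf.Cfg → (X' → Matrix ι ι ℝ) × (J ⊕ J → X' → Matrix ι ι ℝ))
    (cfgC : Bf.Cfg → (X → Matrix ι ι ℝ) × (J ⊕ J → X → Matrix ι ι ℝ)) (τ : J → X ≃ X) (τ' : J → X' ≃ X') (n n' : ℝ) (ν : J) (G D₃ : (X × ι → ℝ) →ₗ[ℝ] (X × ι → ℝ))
    (D : J ⊕ J → (X × ι → ℝ) →ₗ[ℝ] (X × ι → ℝ)) (G' D₃' : (X' × ι → ℝ) →ₗ[ℝ] (X' × ι → ℝ)) (D' : J ⊕ J → (X' × ι → ℝ) →ₗ[ℝ] (X' × ι → ℝ)) :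
    B9.KernelFamily (bgInstanceM₂R blk π m Bc Bf P).gc (bgInstanceM₂R blk π m Bc Bf P).Bf :=
  show B9.KernelFamily (opGeo g (X × ι) (liftBlk blk ι)) Bf from
    opFamily (g := g) (B := Bf) (liftBlk blk ι) (liftBlk (blk ∘ π) ι) (bgOpsM₂R cfgF cfgC π τ τ' n n' ν G D₃ D G' D₃' D')

end Defs

/-! ## §2 Per index `EtaRateIneq342` from the letter bundle -/

section PerIndex

variable {X X' J ι : Type} [Fintype X] [Fintype X'] [Fintype J] [Fintype ι] [DecidableEq X] [DecidableEq X'] [DecidableEq J] [DecidableEq ι]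
  {g : B6.Geometry} (blk : X → g.Site) (π : X' → X) {B : B9.Backgrounds}
variable {τ : J → X ≃ X} {τ' : J → X' ≃ X'} {n n' : ℝ} {G D₃ : (X × ι → ℝ) →ₗ[ℝ] (X × ι → ℝ)} {D : J ⊕ J → (X × ι → ℝ) →ₗ[ℝ] (X × ι → ℝ)}
  {G' D₃' : (X' × ι → ℝ) →ₗ[ℝ] (X' × ι → ℝ)} {D' : J ⊕ J → (X' × ι → ℝ) →ₗ[ℝ] (X' × ι → ℝ)}

/-- **`EtaRateIneq342` PER INDEX FROM THE LETTER BUNDLE** (`B₀ = bgConst(…) + bgConst1(…)` at `K = 1 + |J ⊕ J|`, `a₀ = a` `+ bpConst2L(…)`, `δ₀ = δ − 6σ`): a carrier `B` with readings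
`cfgF, cfgC`, a configuration `U` whose read configurations obey `TwoSidedLetters … a θ`, the guards `β((1+|J ⊕ J|)a)c_r ≤ ½`, `rowConst(|J|, β, c_T, a, c_r)c_r² ≤ ½`, the `U ≡ 1` layer
(pieces, derived pieces over `J ⊕ J`, Laplacian pieces, entry-2 operators, their defects, shifts) and the shift-defect row letter at the coarse forward coefficients; `η, L > 0`, sites of size
`≥ 1`, `θ ≤ (L^j)^{−γ}`.  Entries 0∕1∕3 by g2 V0 `hasMaj_entries_of_letters` (three perturbation letters: M1 `hasMaj_unstackM` ∕ `hasMaj_idef_unstackM`), entry 2 by FILE 23.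
[cite: Balaban1985BackgroundPropagators, Thm 3.1 (3.42) p.397 (shape, quantifier template)] -/
theorem etaRateIneq342_twoSided_of_letters (htri : Triangle254 g) (hd : ∀ a b : g.Site, 0 ≤ g.dist a b) (hd0 : ∀ y : g.Site, g.dist y y = 0) {σ cr : ℝ} (hσ : 0 ≤ σ)
    (hcr : 0 ≤ cr) (hrow : RowSum g σ cr) (hη : 0 < g.eta) (hL : 0 < g.L) (hlen : ∀ y, 1 ≤ g.len y) {δ β m₀ θ a γ cT mT : ℝ} (hσδ : 6 * σ ≤ δ)
    (hβ : 0 ≤ β) (hm₀ : 0 ≤ m₀) (hθ : 0 ≤ θ) (hθγ : ∀ y, θ ≤ rateWeight g γ y) (ha : 0 ≤ a) (hq : β * ((1 + Fintype.card (J ⊕ J)) * a) * cr ≤ 1 / 2) (hcT : 0 ≤ cT)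
    (hmT : 0 ≤ mT) (hq2 : 1 * rowConst (Fintype.card J) β cT a cr * cr * cr ≤ 1 / 2) {ν : J}
    (hG : HasMaj (BlockNorm.ofBlocks g (liftBlk blk ι)) (BlockNorm.ofBlocks g (liftBlk blk ι)) G (fun y y' => β * Real.exp (-(δ * g.dist y y'))))
    (hD : ∀ μ, HasMaj (BlockNorm.ofBlocks g (liftBlk blk ι)) (BlockNorm.ofBlocks g (liftBlk blk ι)) (D μ) (fun y y' => β * Real.exp (-(δ * g.dist y y'))))
    (hG' : HasMaj (BlockNorm.ofBlocks g (liftBlk (blk ∘ π) ι)) (BlockNorm.ofBlocks g (liftBlk (blk ∘ π) ι)) G' (fun y y' => β * Real.exp (-(δ * g.dist y y'))))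
    (hD' : ∀ μ, HasMaj (BlockNorm.ofBlocks g (liftBlk (blk ∘ π) ι)) (BlockNorm.ofBlocks g (liftBlk (blk ∘ π) ι)) (D' μ) (fun y y' => β * Real.exp (-(δ * g.dist y y'))))
    (hD₃' : HasMaj (BlockNorm.ofBlocks g (liftBlk (blk ∘ π) ι)) (BlockNorm.ofBlocks g (liftBlk (blk ∘ π) ι)) D₃' (fun y y' => β * Real.exp (-(δ * g.dist y y'))))
    (hDG : HasMaj (BlockNorm.ofBlocks g (liftBlk blk ι)) (BlockNorm.ofBlocks g (liftBlk (blk ∘ π) ι)) (idef (pull (liftMap π ι)) (pull (liftMap π ι)) G' G)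
      (fun y y' => m₀ * θ * Real.exp (-(δ * g.dist y y'))))
    (hDD : ∀ μ, HasMaj (BlockNorm.ofBlocks g (liftBlk blk ι)) (BlockNorm.ofBlocks g (liftBlk (blk ∘ π) ι)) (idef (pull (liftMap π ι)) (pull (liftMap π ι)) (D' μ) (D μ))
      (fun y y' => m₀ * θ * Real.exp (-(δ * g.dist y y'))))
    (hDD₃ : HasMaj (BlockNorm.ofBlocks g (liftBlk blk ι)) (BlockNorm.ofBlocks g (liftBlk (blk ∘ π) ι)) (idef (pull (liftMap π ι)) (pull (liftMap π ι)) D₃' D₃)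
      (fun y y' => m₀ * θ * Real.exp (-(δ * g.dist y y'))))
    (hS : ∀ ν, HasMaj (BlockNorm.ofBlocks g (liftBlk blk ι)) (BlockNorm.ofBlocks g (liftBlk blk ι)) (G ∘ₗ fgradAdj n (liftEquiv (τ ν) ι)) (fun y y' => β * Real.exp (-(δ * g.dist y y'))))
    (hS' : ∀ ν, HasMaj (BlockNorm.ofBlocks g (liftBlk (blk ∘ π) ι)) (BlockNorm.ofBlocks g (liftBlk (blk ∘ π) ι)) (G' ∘ₗ fgradAdj n' (liftEquiv (τ' ν) ι)) (fun y y' => β * Real.exp (-(δ * g.dist y y'))))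
    (hDS : ∀ ν, HasMaj (BlockNorm.ofBlocks g (liftBlk blk ι)) (BlockNorm.ofBlocks g (liftBlk (blk ∘ π) ι))
      (idef (pull (liftMap π ι)) (pull (liftMap π ι)) (G' ∘ₗ fgradAdj n' (liftEquiv (τ' ν) ι)) (G ∘ₗ fgradAdj n (liftEquiv (τ ν) ι))) (fun y y' => m₀ * θ * Real.exp (-(δ * g.dist y y'))))
    (hSh : ∀ μ, HasMaj (BlockNorm.ofBlocks g (liftBlk blk ι)) (BlockNorm.ofBlocks g (liftBlk blk ι)) (pull (liftEquiv (τ μ) ι)) (fun y y' => cT * Real.exp (-(δ * g.dist y y'))))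
    (hSh' : ∀ μ, HasMaj (BlockNorm.ofBlocks g (liftBlk (blk ∘ π) ι)) (BlockNorm.ofBlocks g (liftBlk (blk ∘ π) ι)) (pull (liftEquiv (τ' μ) ι)) (fun y y' => cT * Real.exp (-(δ * g.dist y y'))))
    {cfgF : B.Cfg → (X' → Matrix ι ι ℝ) × (J ⊕ J → X' → Matrix ι ι ℝ)} {cfgC : B.Cfg → (X → Matrix ι ι ℝ) × (J ⊕ J → X → Matrix ι ι ℝ)} {U : B.Cfg}
    (hLt : TwoSidedLetters J ι π τ τ' n n' a θ (cfgF U) (cfgC U))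
    (hDSh : ∀ μ, HasMaj (BlockNorm.ofBlocks g (liftBlk (liftBlk blk ι) J)) (BlockNorm.ofBlocks g (liftBlk (blk ∘ π) ι))
      (idef (pull (liftMap π ι)) (pull (liftMap π ι)) (pull (liftEquiv (τ' μ) ι)) (pull (liftEquiv (τ μ) ι)) ∘ₗ
        (mmulOp ((cfgC U).2 (Sum.inl μ) ∘ ⇑(τ μ).symm) ∘ₗ sumJ fun ν => G ∘ₗ fgradAdj n (liftEquiv (τ ν) ι))) (fun y y' => mT * θ * Real.exp (-(δ * g.dist y y')))) :
    EtaRateIneq342 (opFamily (g := g) (B := B) (liftBlk blk ι) (liftBlk (blk ∘ π) ι) (bgOpsM₂R cfgF cfgC π τ τ' n n' ν G D₃ D G' D₃' D'))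
      (bgConst β cr m₀ (1 + Fintype.card (J ⊕ J)) a + bgConst1 β cr m₀ (1 + Fintype.card (J ⊕ J)) a + bpConst2L (Fintype.card J) (Fintype.card (J ⊕ J)) β cr m₀ a cT mT)
      (δ - 6 * σ) γ U := by
  obtain ⟨hc, hA, hc', hA', hfc, hfA, hga, hga', hgb, hgb', hfaT, hfgT, -, hfbT, hfgb⟩ := hLt
  have hnJ : (0 : ℝ) ≤ Fintype.card J := Nat.cast_nonneg _
  have hnJ2 : (0 : ℝ) ≤ Fintype.card (J ⊕ J) := Nat.cast_nonneg _
  have hJ0 : (0 : ℝ) ≤ 1 + Fintype.card (J ⊕ J) := by positivity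
  have haθ : 0 ≤ a * θ := mul_nonneg ha hθ
  have hσδ' : σ ≤ δ := by linarith
  have hR0 : 0 ≤ a * (1 + Fintype.card (J ⊕ J)) := mul_nonneg ha hJ0
  -- V0: entries 0∕1∕3 from the three perturbation letters (mixed slots fed with zeros)
  have hz : ∀ {F₁ F₂ : Type} [AddCommGroup F₁] [Module ℝ F₁] [AddCommGroup F₂] [Module ℝ F₂] (b₁ : BlockNorm g F₁) (b₂ : BlockNorm g F₂) (c : ℝ), 0 ≤ c →
      HasMaj b₁ b₂ (0 : F₁ →ₗ[ℝ] F₂) (fun y y' => c * Real.exp (-(δ * g.dist y y'))) := fun b₁ b₂ c hc0 =>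
    (hasMaj_zero b₁ b₂).mono fun _ _ => mul_nonneg hc0 (Real.exp_nonneg _)
  have hV : HasMaj (BlockNorm.ofBlocks g (blkPair (liftBlk blk ι))) (BlockNorm.ofBlocks g (liftBlk blk ι)) (unstackM (cfgC U).1 (cfgC U).2)
      (diagK fun _ => a * (1 + Fintype.card (J ⊕ J))) := hasMaj_unstackM blk ha hc hA
  have hV' : HasMaj (BlockNorm.ofBlocks g (blkPair (liftBlk (blk ∘ π) ι))) (BlockNorm.ofBlocks g (liftBlk (blk ∘ π) ι)) (unstackM (cfgF U).1 (cfgF U).2)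
      (diagK fun _ => a * (1 + Fintype.card (J ⊕ J))) := hasMaj_unstackM (blk ∘ π) ha hc' hA'
  have hDV : HasMaj (BlockNorm.ofBlocks g (blkPair (liftBlk blk ι))) (BlockNorm.ofBlocks g (liftBlk (blk ∘ π) ι))
      (idef (pull (liftPair (liftMap π ι))) (pull (liftMap π ι)) (unstackM (cfgF U).1 (cfgF U).2) (unstackM (cfgC U).1 (cfgC U).2))
      (diagK fun _ => a * (1 + Fintype.card (J ⊕ J)) * θ) :=
    (hasMaj_idef_unstackM blk π haθ hfc hfA).mono fun y y' =>
      T4EtaRateCoeffDefect.diagK_mono (fun _ => (by ring : a * θ * (1 + (Fintype.card (J ⊕ J) : ℝ)) = a * (1 + Fintype.card (J ⊕ J)) * θ).le) y y'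
  have h013 := hasMaj_entries_of_letters (liftBlk blk ι) (liftMap π ι) htri hd hσ hcr hrow hσδ' hβ hm₀ hθ hJ0 ha hq hR0
    (le_of_eq (by ring)) hG hD hG' hD' (hz _ _ β hβ) (S := 0) (SD := fun _ => 0) (S' := 0) (SD' := fun _ => 0) (fun _ => hz _ _ β hβ) hD₃'
    hDG hDD (by rw [idef_zero]; exact hz _ _ (m₀ * θ) (mul_nonneg hm₀ hθ)) (fun _ => by rw [idef_zero]; exact hz _ _ (m₀ * θ) (mul_nonneg hm₀ hθ)) hDD₃ hV hV' hDV
  have h01 := h013.1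
  have h3 := h013.2.2
  have h2 := hasMaj_entry2_byParts_matrix₂_of_letters blk π htri hd hd0 hσ hcr hrow hσδ hβ hm₀ hθ ha hq hcT hmT hq2 hG hD hG' hD' hDG hDD hS hS' hDS hSh hSh'
    hc hA hc' hA' hfc hfA hga hga' hgb hgb' hfaT hfgT hfbT hfgb hDSh ν
  have hC0 : 0 ≤ bgConst β cr m₀ (1 + Fintype.card (J ⊕ J)) a := bgConst_nonneg hβ hcr hm₀ hJ0 ha
  have hC1 : 0 ≤ bgConst1 β cr m₀ (1 + Fintype.card (J ⊕ J)) a := bgConst1_nonneg hβ hcr hm₀ hJ0 ha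
  have hC2 : 0 ≤ bpConst2L (Fintype.card J) (Fintype.card (J ⊕ J)) β cr m₀ a cT mT := bpConst2L_nonneg hnJ hnJ2 hβ hcr hm₀ ha hcT hmT (by linarith)
  set B₀ := bgConst β cr m₀ (1 + Fintype.card (J ⊕ J)) a + bgConst1 β cr m₀ (1 + Fintype.card (J ⊕ J)) a + bpConst2L (Fintype.card J) (Fintype.card (J ⊕ J)) β cr m₀ a cT mT
    with hB₀def
  have hB₀ : 0 ≤ B₀ := add_nonneg (add_nonneg hC0 hC1) hC2
  -- the readout in the (3.42) shape
  refine etaRateIneq342_of_hasMaj_rateWeight (g := g) (B := B) (liftBlk blk ι) (liftBlk (blk ∘ π) ι) hη hL hB₀ (c := fun _ => B₀) (fun _ => hB₀)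
    (fun k y => le_mul_of_one_le_right hB₀ (one_le_pref4 (hlen y) k)) (bgOpsM₂R cfgF cfgC π τ τ' n n' ν G D₃ D G' D₃' D') U fun k => ?_
  have hmono : ∀ {B ρ : ℝ}, 0 ≤ B → B ≤ B₀ → δ - 6 * σ ≤ ρ → ∀ y y' : g.Site,
      B * θ * Real.exp (-(ρ * g.dist y y')) ≤ B₀ * Real.exp (-((δ - 6 * σ) * g.dist y y')) * rateWeight g γ y' := by
    intro B ρ hB0 hB hρ y y'
    have hexp : Real.exp (-(ρ * g.dist y y')) ≤ Real.exp (-((δ - 6 * σ) * g.dist y y')) :=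
      Real.exp_le_exp.mpr (neg_le_neg (mul_le_mul_of_nonneg_right hρ (hd y y')))
    calc B * θ * Real.exp (-(ρ * g.dist y y')) ≤ B₀ * rateWeight g γ y' * Real.exp (-((δ - 6 * σ) * g.dist y y')) :=
          mul_le_mul (mul_le_mul hB (hθγ y') hθ hB₀) hexp (Real.exp_nonneg _) (mul_nonneg hB₀ (hθ.trans (hθγ y')))
      _ = B₀ * Real.exp (-((δ - 6 * σ) * g.dist y y')) * rateWeight g γ y' := by ring
  fin_cases k
  · exact (h01 none).mono (hmono hC0 (by rw [hB₀def]; linarith) (by linarith))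
  · exact (h01 (some (Sum.inl ν))).mono (hmono hC0 (by rw [hB₀def]; linarith) (by linarith))
  · exact h2.mono (hmono hC2 (by rw [hB₀def]; linarith) le_rfl)
  · exact h3.mono (hmono hC1 (by rw [hB₀def]; linarith) (by linarith))

end PerIndex

/-! ## §3 The node theorem: `NE2PlusOperator` by name from the letter bundle -/

section Node

variable {I J ι : Type} [Fintype J] [DecidableEq J] [Fintype ι] [DecidableEq ι] (g : I → B6.Geometry) (X X' : I → Type) [∀ i, Fintype (X i)]
  [∀ i, Fintype (X' i)] [∀ i, DecidableEq (X i)] [∀ i, DecidableEq (X' i)] (blk : ∀ i, X i → (g i).Site) (π : ∀ i, X' i → X i) (τ : ∀ i, J → X i ≃ X i)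
  (τ' : ∀ i, J → X' i ≃ X' i) (n n' : I → ℝ) (nsh : I → ℕ) (Bc Bf : I → B9.Backgrounds)
  (P : ∀ i, EtaPairing (opGeo (g i) (X i × ι) (liftBlk (blk i) ι)) (fineGeo (g i) (X' i × ι) (liftBlk (blk i ∘ π i) ι) (nsh i)) (Bc i) (Bf i))
  (cfgF : ∀ i, (Bf i).Cfg → (X' i → Matrix ι ι ℝ) × (J ⊕ J → X' i → Matrix ι ι ℝ)) (cfgC : ∀ i, (Bf i).Cfg → (X i → Matrix ι ι ℝ) × (J ⊕ J → X i → Matrix ι ι ℝ))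
  (θ : I → ℝ) (ν : I → J) (G D₃ : ∀ i, (X i × ι → ℝ) →ₗ[ℝ] (X i × ι → ℝ)) (D : ∀ i, J ⊕ J → (X i × ι → ℝ) →ₗ[ℝ] (X i × ι → ℝ))
  (G' D₃' : ∀ i, (X' i × ι → ℝ) →ₗ[ℝ] (X' i × ι → ℝ)) (D' : ∀ i, J ⊕ J → (X' i × ι → ℝ) →ₗ[ℝ] (X' i × ι → ℝ))

/-- ★★★ **NE2⁺, OPERATOR LAYER — `T4EtaRate.NE2PlusOperator` BY NAME FOR THE TWO-SIDED BY-PARTS MATRIX FAMILY OVER AN ARBITRARY COEFFICIENT-CARRIER PAIR WHOSE (3.35) REGULARITY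
DELIVERS THE LETTER BUNDLE.**  For ANY family of realised instances `⟨opGeo, fineGeo, B_c, B_f, P⟩` with readings `cfgF_i, cfgC_i` of the fine ∕ coarse coefficient configurations such
that, for every configuration `U` regular at level `c₃₅` with window `α₀ > 0` (and `M ≥ 1`), the fifteen letters `TwoSidedLetters … (κ·c₃₅Mα₀) θ_i (cfgF_i U) (cfgC_i U)` hold together
with the shift-defect row letter at the coarse forward coefficients (`≤ m_T·(κc₃₅Mα₀)·θ_ie^{−δd}`, linear in the scale); with the UNIFORM `U ≡ 1` letters of FILE 20 at rate `δ`
(`6σ < δ`): pieces, derived pieces over `J ⊕ J`, the fine Laplacian piece, the `U ≡ 1` entry-2 operators `G_i∇_ν*, G′_i∇′_ν*`, the η-defects (`≤ m₀θ_ie^{−δd}`), the one-step shifts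
(`≤ c_Te^{−δd}`); `0 ≤ θ_i ≤ (L^j)^{−γ}`, `γ > 0`; [B6] carriers; `η, L > 0`, sites of size `≥ 1`; `c₃₅, κ, r₀ > 0` (the letters are demanded only in the WINDOW
`c₃₅Mα₀ ≤ r₀`, where the `ad`-polynomial coefficients are controlled) —: `NE2PlusOperator c₃₅ (bgInstanceM₂R …) (bgFamilyM₂R …)` with `M₅ = 1`,
`a₀ = min((2κc₃₅(1+|J ⊕ J|)(βc_r+1))⁻¹, (2(K+1))⁻¹, r₀∕c₃₅)` (`K = (c_T+1)κc₃₅|J|βc_r³`), `B₀ = bgConst + bgConst1 + bpConst2L(…, m_Tκc₃₅a₀) + 1` at scale `κc₃₅a₀`, `δ₀ = δ − 6σ`.  This is the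
socket for Bałaban's OWN species (3.52): its coarse coefficients are `ad`-polynomials of the COARSE gauge field (readings, not block averages).
[cite: Balaban1985BackgroundPropagators, Thm 3.1 p.397 (quantifier template); (3.35)–(3.36) p.396, (3.42) p.397, (3.52) p.400 (shapes, mechanism)] -/
theorem ne2PlusOperator_twoSided_of_letters (c35 κ r₀ : ℝ) (hc35 : 0 < c35) (hκ : 0 < κ) (hr₀ : 0 < r₀)
    (htri : ∀ i, Triangle254 (g i)) (hd : ∀ i (a b : (g i).Site), 0 ≤ (g i).dist a b) (hd0 : ∀ i (y : (g i).Site), (g i).dist y y = 0) {σ cr : ℝ} (hσ : 0 ≤ σ)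
    (hcr : 0 ≤ cr) (hrow : ∀ i, RowSum (g i) σ cr) (hη : ∀ i, 0 < (g i).eta) (hL : ∀ i, 0 < (g i).L) (hlen : ∀ i y, 1 ≤ (g i).len y)
    {δ β m₀ γ cT mT : ℝ} (hσδ : 6 * σ < δ) (hβ : 0 ≤ β) (hm₀ : 0 ≤ m₀) (hγ : 0 < γ) (hθ : ∀ i, 0 ≤ θ i) (hθγ : ∀ i y, θ i ≤ rateWeight (g i) γ y) (hcT : 0 ≤ cT) (hmT : 0 ≤ mT)
    (hG : ∀ i, HasMaj (BlockNorm.ofBlocks (g i) (liftBlk (blk i) ι)) (BlockNorm.ofBlocks (g i) (liftBlk (blk i) ι)) (G i) (fun y y' => β * Real.exp (-(δ * (g i).dist y y'))))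
    (hD : ∀ i μ, HasMaj (BlockNorm.ofBlocks (g i) (liftBlk (blk i) ι)) (BlockNorm.ofBlocks (g i) (liftBlk (blk i) ι)) (D i μ) (fun y y' => β * Real.exp (-(δ * (g i).dist y y'))))
    (hG' : ∀ i, HasMaj (BlockNorm.ofBlocks (g i) (liftBlk (blk i ∘ π i) ι)) (BlockNorm.ofBlocks (g i) (liftBlk (blk i ∘ π i) ι)) (G' i) (fun y y' => β * Real.exp (-(δ * (g i).dist y y'))))
    (hD' : ∀ i μ, HasMaj (BlockNorm.ofBlocks (g i) (liftBlk (blk i ∘ π i) ι)) (BlockNorm.ofBlocks (g i) (liftBlk (blk i ∘ π i) ι)) (D' i μ)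
      (fun y y' => β * Real.exp (-(δ * (g i).dist y y'))))
    (hD₃' : ∀ i, HasMaj (BlockNorm.ofBlocks (g i) (liftBlk (blk i ∘ π i) ι)) (BlockNorm.ofBlocks (g i) (liftBlk (blk i ∘ π i) ι)) (D₃' i) (fun y y' => β * Real.exp (-(δ * (g i).dist y y'))))
    (hDG : ∀ i, HasMaj (BlockNorm.ofBlocks (g i) (liftBlk (blk i) ι)) (BlockNorm.ofBlocks (g i) (liftBlk (blk i ∘ π i) ι)) (idef (pull (liftMap (π i) ι)) (pull (liftMap (π i) ι)) (G' i) (G i))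
      (fun y y' => m₀ * θ i * Real.exp (-(δ * (g i).dist y y'))))
    (hDD : ∀ i μ, HasMaj (BlockNorm.ofBlocks (g i) (liftBlk (blk i) ι)) (BlockNorm.ofBlocks (g i) (liftBlk (blk i ∘ π i) ι))
      (idef (pull (liftMap (π i) ι)) (pull (liftMap (π i) ι)) (D' i μ) (D i μ)) (fun y y' => m₀ * θ i * Real.exp (-(δ * (g i).dist y y'))))
    (hDD₃ : ∀ i, HasMaj (BlockNorm.ofBlocks (g i) (liftBlk (blk i) ι)) (BlockNorm.ofBlocks (g i) (liftBlk (blk i ∘ π i) ι))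
      (idef (pull (liftMap (π i) ι)) (pull (liftMap (π i) ι)) (D₃' i) (D₃ i)) (fun y y' => m₀ * θ i * Real.exp (-(δ * (g i).dist y y'))))
    (hS : ∀ i ν, HasMaj (BlockNorm.ofBlocks (g i) (liftBlk (blk i) ι)) (BlockNorm.ofBlocks (g i) (liftBlk (blk i) ι)) (G i ∘ₗ fgradAdj (n i) (liftEquiv (τ i ν) ι))
      (fun y y' => β * Real.exp (-(δ * (g i).dist y y'))))
    (hS' : ∀ i ν, HasMaj (BlockNorm.ofBlocks (g i) (liftBlk (blk i ∘ π i) ι)) (BlockNorm.ofBlocks (g i) (liftBlk (blk i ∘ π i) ι)) (G' i ∘ₗ fgradAdj (n' i) (liftEquiv (τ' i ν) ι))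
      (fun y y' => β * Real.exp (-(δ * (g i).dist y y'))))
    (hDS : ∀ i ν, HasMaj (BlockNorm.ofBlocks (g i) (liftBlk (blk i) ι)) (BlockNorm.ofBlocks (g i) (liftBlk (blk i ∘ π i) ι))
      (idef (pull (liftMap (π i) ι)) (pull (liftMap (π i) ι)) (G' i ∘ₗ fgradAdj (n' i) (liftEquiv (τ' i ν) ι)) (G i ∘ₗ fgradAdj (n i) (liftEquiv (τ i ν) ι)))
      (fun y y' => m₀ * θ i * Real.exp (-(δ * (g i).dist y y'))))
    (hSh : ∀ i μ, HasMaj (BlockNorm.ofBlocks (g i) (liftBlk (blk i) ι)) (BlockNorm.ofBlocks (g i) (liftBlk (blk i) ι)) (pull (liftEquiv (τ i μ) ι)) (fun y y' => cT * Real.exp (-(δ * (g i).dist y y'))))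
    (hSh' : ∀ i μ, HasMaj (BlockNorm.ofBlocks (g i) (liftBlk (blk i ∘ π i) ι)) (BlockNorm.ofBlocks (g i) (liftBlk (blk i ∘ π i) ι)) (pull (liftEquiv (τ' i μ) ι))
      (fun y y' => cT * Real.exp (-(δ * (g i).dist y y'))))
    (hLt : ∀ i (U : (Bf i).Cfg) (α₀ : ℝ), (Bf i).Reg335 c35 α₀ U → 0 < α₀ → 1 ≤ (g i).M → c35 * (g i).M * α₀ ≤ r₀ →
      TwoSidedLetters J ι (π i) (τ i) (τ' i) (n i) (n' i) (κ * (c35 * (g i).M * α₀)) (θ i) (cfgF i U) (cfgC i U))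
    (hDSh : ∀ i (U : (Bf i).Cfg) (α₀ : ℝ), (Bf i).Reg335 c35 α₀ U → 0 < α₀ → 1 ≤ (g i).M → c35 * (g i).M * α₀ ≤ r₀ →
      ∀ μ, HasMaj (BlockNorm.ofBlocks (g i) (liftBlk (liftBlk (blk i) ι) J)) (BlockNorm.ofBlocks (g i) (liftBlk (blk i ∘ π i) ι))
        (idef (pull (liftMap (π i) ι)) (pull (liftMap (π i) ι)) (pull (liftEquiv (τ' i μ) ι)) (pull (liftEquiv (τ i μ) ι)) ∘ₗ
          (mmulOp ((cfgC i U).2 (Sum.inl μ) ∘ ⇑(τ i μ).symm) ∘ₗ sumJ fun ν => G i ∘ₗ fgradAdj (n i) (liftEquiv (τ i ν) ι)))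
        (fun y y' => mT * (κ * (c35 * (g i).M * α₀)) * θ i * Real.exp (-(δ * (g i).dist y y')))) :
    NE2PlusOperator c35 (fun i => bgInstanceM₂R (blk i) (π i) (nsh i) (Bc i) (Bf i) (P i))
      (fun i => bgFamilyM₂R (blk i) (π i) (nsh i) (Bc i) (Bf i) (P i) (cfgF i) (cfgC i) (τ i) (τ' i) (n i) (n' i) (ν i) (G i) (D₃ i) (D i) (G' i) (D₃' i) (D' i)) := by
  have hnJ : (0 : ℝ) ≤ Fintype.card J := Nat.cast_nonneg _
  have hnJ2 : (0 : ℝ) ≤ Fintype.card (J ⊕ J) := Nat.cast_nonneg _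
  have hJ1 : (1 : ℝ) ≤ 1 + Fintype.card (J ⊕ J) := le_add_of_nonneg_right hnJ2
  have hJ0 : (0 : ℝ) < 1 + Fintype.card (J ⊕ J) := lt_of_lt_of_le one_pos hJ1
  have hκc : 0 < κ * c35 := mul_pos hκ hc35
  -- the guard constant of the perturbation series and the by-parts one
  set a₁ : ℝ := (2 * ((κ * c35) * (1 + Fintype.card (J ⊕ J))) * (β * cr + 1))⁻¹ with ha₁_def
  set a₂ : ℝ := (2 * ((cT + 1) * (κ * c35) * Fintype.card J * β * (cr * cr * cr) + 1))⁻¹ with ha₂_def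
  have hden₁ : 0 < 2 * ((κ * c35) * (1 + Fintype.card (J ⊕ J))) * (β * cr + 1) := by positivity
  have hden₂ : 0 < 2 * ((cT + 1) * (κ * c35) * Fintype.card J * β * (cr * cr * cr) + 1) := by positivity
  have ha₁ : 0 < a₁ := inv_pos.2 hden₁
  have ha₂ : 0 < a₂ := inv_pos.2 hden₂
  set a₀ : ℝ := min (min a₁ a₂) (r₀ / c35) with ha₀_def
  have ha₀ : 0 < a₀ := lt_min (lt_min ha₁ ha₂) (div_pos hr₀ hc35)
  have ha₀₁ : a₀ ≤ a₁ := (min_le_left _ _).trans (min_le_left _ _)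
  have ha₀₂ : a₀ ≤ a₂ := (min_le_left _ _).trans (min_le_right _ _)
  have ha₀r : c35 * a₀ ≤ r₀ := by
    have h := min_le_right (min a₁ a₂) (r₀ / c35)
    rw [← ha₀_def] at h
    calc c35 * a₀ ≤ c35 * (r₀ / c35) := mul_le_mul_of_nonneg_left h hc35.le
      _ = r₀ := mul_div_cancel₀ r₀ hc35.ne'
  have hA0 : 0 ≤ κ * c35 * a₀ := by positivity
  have hq : β * ((1 + Fintype.card (J ⊕ J)) * (κ * c35 * a₀)) * cr ≤ 1 / 2 := by
    have hq₁ : β * ((1 + Fintype.card (J ⊕ J)) * (κ * c35 * a₁)) * cr ≤ 1 / 2 := by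
      have h1 : β * ((1 + Fintype.card (J ⊕ J)) * (κ * c35 * a₁)) * cr = (β * cr) * ((κ * c35) * (1 + Fintype.card (J ⊕ J)) * a₁) := by ring
      have h2 : (κ * c35) * (1 + Fintype.card (J ⊕ J)) * a₁ = (2 * (β * cr + 1))⁻¹ := by
        rw [ha₁_def]; field_simp
      rw [h1, h2, ← div_eq_mul_inv, div_le_iff₀ (by positivity)]
      nlinarith [mul_nonneg hβ hcr]
    refine le_trans ?_ hq₁
    have h0 : 0 ≤ β * ((1 + Fintype.card (J ⊕ J)) * (κ * c35)) * cr := by positivity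
    nlinarith
  have hq2 : 1 * rowConst (Fintype.card J) β cT (κ * c35 * a₀) cr * cr * cr ≤ 1 / 2 :=
    rowConst_small hnJ hβ hcT hκc.le hcr ha₀₂
  have hC0 : 0 ≤ bgConst β cr m₀ (1 + Fintype.card (J ⊕ J)) (κ * c35 * a₀) := bgConst_nonneg hβ hcr hm₀ hJ0.le hA0
  have hC1 : 0 ≤ bgConst1 β cr m₀ (1 + Fintype.card (J ⊕ J)) (κ * c35 * a₀) := bgConst1_nonneg hβ hcr hm₀ hJ0.le hA0
  have hmT' : 0 ≤ mT * (κ * c35 * a₀) := mul_nonneg hmT hA0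
  have hC2 : 0 ≤ bpConst2L (Fintype.card J) (Fintype.card (J ⊕ J)) β cr m₀ (κ * c35 * a₀) cT (mT * (κ * c35 * a₀)) :=
    bpConst2L_nonneg hnJ hnJ2 hβ hcr hm₀ hA0 hcT hmT' (by linarith)
  refine ⟨1, δ - 6 * σ, a₀, bgConst β cr m₀ (1 + Fintype.card (J ⊕ J)) (κ * c35 * a₀) + bgConst1 β cr m₀ (1 + Fintype.card (J ⊕ J)) (κ * c35 * a₀) +
    bpConst2L (Fintype.card J) (Fintype.card (J ⊕ J)) β cr m₀ (κ * c35 * a₀) cT (mT * (κ * c35 * a₀)) + 1, γ, one_pos, by linarith, ha₀, by linarith, hγ,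
    fun i hM α₀ hα₀ hMα U hreg => ?_⟩
  have hM' : 1 ≤ (g i).M := hM
  have hMα' : (g i).M * α₀ ≤ a₀ := hMα
  have hgd : c35 * (g i).M * α₀ ≤ r₀ := by
    calc c35 * (g i).M * α₀ = c35 * ((g i).M * α₀) := by ring
      _ ≤ c35 * a₀ := mul_le_mul_of_nonneg_left hMα' hc35.le
      _ ≤ r₀ := ha₀r
  have hsc : κ * (c35 * (g i).M * α₀) ≤ κ * c35 * a₀ := by
    calc κ * (c35 * (g i).M * α₀) = κ * c35 * ((g i).M * α₀) := by ring
      _ ≤ κ * c35 * a₀ := mul_le_mul_of_nonneg_left hMα' hκc.le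
  -- the letters and the shift-defect row letter under the guard: scale `κc₃₅Mα₀ ≤ κc₃₅a₀`, window `c₃₅Mα₀ ≤ c₃₅a₀ ≤ r₀`
  have hLt' : TwoSidedLetters J ι (π i) (τ i) (τ' i) (n i) (n' i) (κ * c35 * a₀) (θ i) (cfgF i U) (cfgC i U) :=
    (hLt i U α₀ hreg hα₀ hM' hgd).mono hsc (hθ i)
  have hDSh' : ∀ μ, HasMaj (BlockNorm.ofBlocks (g i) (liftBlk (liftBlk (blk i) ι) J)) (BlockNorm.ofBlocks (g i) (liftBlk (blk i ∘ π i) ι))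
      (idef (pull (liftMap (π i) ι)) (pull (liftMap (π i) ι)) (pull (liftEquiv (τ' i μ) ι)) (pull (liftEquiv (τ i μ) ι)) ∘ₗ
        (mmulOp ((cfgC i U).2 (Sum.inl μ) ∘ ⇑(τ i μ).symm) ∘ₗ sumJ fun ν => G i ∘ₗ fgradAdj (n i) (liftEquiv (τ i ν) ι)))
      (fun y y' => mT * (κ * c35 * a₀) * θ i * Real.exp (-(δ * (g i).dist y y'))) := fun μ =>
    (hDSh i U α₀ hreg hα₀ hM' hgd μ).mono fun y y' => by
      have h2 : 0 ≤ θ i * Real.exp (-(δ * (g i).dist y y')) := mul_nonneg (hθ i) (Real.exp_nonneg _)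
      nlinarith [mul_le_mul_of_nonneg_left hsc hmT]
  have key := etaRateIneq342_twoSided_of_letters (J := J) (ι := ι) (B := Bf i) (blk i) (π i) (htri i) (hd i) (hd0 i) hσ hcr (hrow i) (hη i) (hL i) (hlen i) hσδ.le hβ hm₀
    (hθ i) (hθγ i) hA0 hq hcT hmT' hq2 (ν := ν i) (hG i) (hD i) (hG' i) (hD' i) (hD₃' i) (hDG i) (hDD i) (hDD₃ i) (hS i) (hS' i) (hDS i) (hSh i) (hSh' i)
    (cfgF := cfgF i) (cfgC := cfgC i) (U := U) hLt' hDSh'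
  intro k lam y y' hs
  refine (key k lam y y' hs).trans ?_
  have hpref : 0 ≤ B9.pref4 ((bgInstanceM₂R (blk i) (π i) (nsh i) (Bc i) (Bf i) (P i)).gc.len y) k := by
    have : 1 ≤ B9.pref4 ((opGeo (g i) (X i × ι) (liftBlk (blk i) ι)).len y) k := by rw [opGeo_len]; exact one_le_pref4 (hlen i y) k
    exact zero_le_one.trans this
  have hrf : 0 ≤ max (rateFactor (bgInstanceM₂R (blk i) (π i) (nsh i) (Bc i) (Bf i) (P i)).gc γ y) (rateFactor (bgInstanceM₂R (blk i) (π i) (nsh i) (Bc i) (Bf i) (P i)).gc γ y') :=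
    (T4EtaRate.rateFactor_nonneg (g := opGeo (g i) (X i × ι) (liftBlk (blk i) ι)) (hη i).le (hL i).le γ y).trans (le_max_left _ _)
  have hnorm : 0 ≤ (bgInstanceM₂R (blk i) (π i) (nsh i) (Bc i) (Bf i) (P i)).gc.supNorm lam := Real.iSup_nonneg fun x => abs_nonneg _
  have hE : 0 ≤ Real.exp (-((δ - 6 * σ) * (bgInstanceM₂R (blk i) (π i) (nsh i) (Bc i) (Bf i) (P i)).gc.dist y y')) := Real.exp_nonneg _
  exact mul_le_mul_of_nonneg_right (mul_le_mul_of_nonneg_right (mul_le_mul_of_nonneg_right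
    (mul_le_mul_of_nonneg_right (le_add_of_nonneg_right zero_le_one) hpref) hE) hrf) hnorm

end Node

end Summit.QuantumFields.YangMills.BalabanUVNodes.N15.BackgroundLayer

end
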